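import Literature.Barriers.Parity.SiegelZeroDichotomyChowlaMajorant
import Literature.Barriers.Parity.SiegelZeroDichotomyChowlaTools
import HarnessLib

/-!
# Step (iii) of Tao–Teräväinen at `k = 0`: Proposition 6.3 from Lemma 6.1
# (`TaoTeravainen2021_prop63_k0` reduced to `TaoTeravainen2021_lemma61`)

Topic `Literature/Barriers/Parity`; part of the proof DAG of
`Literature.Barriers.Parity.TaoTeravainen2021_chowla` (`SiegelZeroDichotomyChowla.lean`). PROVED here:

* `TaoTeravainen2021_prop63_k0_of_lemma61 : TaoTeravainen2021_lemma61 → TaoTeravainen2021_prop63_k0`.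

This is the proof of Proposition 6.3 in the source at `k = 0`: "From Lemma 6.1 we have
`λ♯_Siegel(n+h'ⱼ) = λ_Siegel(n+h'ⱼ) + O(H(n+h'ⱼ))` for `j = 1,…,ℓ`. Multiplying these estimates using
(4.2) and the triangle inequality, and relabeling, we reduce to showing that
`𝔼_{n ≤ x} H(n+h'₁)⋯H(n+h'_{ℓ'}) ≈ 0` for any `1 ≤ ℓ' ≤ ℓ`" — here: expand
`∏ (λ_Siegel + (λ♯_Siegel - λ_Siegel))` over subsets (`abs_prod_sub_prod_add_le`), bound each
non-empty sub-product by `C^{ℓ} ∏_{a ∈ t} H(n+a)`, and use the count of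
`SiegelZeroDichotomyChowlaMajorant.lean` (`sum_prod_majorant_le`, the `k = 0` case of Lemma 3.4 /
(6.13)) with (6.6) at `A = 1`: the result is `≪ exp(-⅛ log_R D) = exp(-ε₀ log^{1/5} η/(80ℓ))`
((2.12)), which is `≪ log^{-1/10} η`. [cite: TaoTeravainen2021, proof of Proposition 6.3, Lemma 6.1, (2.12)]
-/

noncomputable section

open Finset Real

namespace Literature.Barriers.Parity

namespace TaoTeravainen

/-- **Multiplying the estimates** ("using (4.2) and the triangle inequality"): for `|gᵢ| ≤ 1`,
`|∏ gᵢ - ∏ (gᵢ + bᵢ)| ≤ ∑_{∅ ≠ t ⊆ s} ∏_{i ∈ t} |bᵢ|`. [cite: TaoTeravainen2021, proof of Proposition 6.3] -/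
theorem abs_prod_sub_prod_add_le {ι : Type*} [DecidableEq ι] (s : Finset ι) (g b : ι → ℝ)
    (hg : ∀ i ∈ s, |g i| ≤ 1) :
    |∏ i ∈ s, g i - ∏ i ∈ s, (g i + b i)| ≤ ∑ t ∈ s.powerset.erase ∅, ∏ i ∈ t, |b i| := by
  have h1 : ∏ i ∈ s, (g i + b i) = ∑ t ∈ s.powerset, (∏ i ∈ t, b i) * ∏ i ∈ s \ t, g i := by
    rw [← Finset.prod_add]
    exact prod_congr rfl fun i _ => add_comm _ _
  have h0 : (∅ : Finset ι) ∈ s.powerset := empty_mem_powerset s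
  rw [h1, ← add_sum_erase _ _ h0, prod_empty, one_mul, sdiff_empty,
    show ∏ i ∈ s, g i - (∏ i ∈ s, g i + ∑ t ∈ s.powerset.erase ∅, (∏ i ∈ t, b i) * ∏ i ∈ s \ t, g i)
      = -∑ t ∈ s.powerset.erase ∅, (∏ i ∈ t, b i) * ∏ i ∈ s \ t, g i by ring, abs_neg]
  refine (abs_sum_le_sum_abs _ _).trans (sum_le_sum fun t _ => ?_)
  rw [abs_mul, abs_prod, abs_prod]
  have h2 : ∏ i ∈ s \ t, |g i| ≤ 1 :=
    prod_le_one (fun _ _ => abs_nonneg _) fun i hi => hg i (mem_sdiff.mp hi).1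
  calc (∏ i ∈ t, |b i|) * ∏ i ∈ s \ t, |g i| ≤ (∏ i ∈ t, |b i|) * 1 :=
        mul_le_mul_of_nonneg_left h2 (prod_nonneg fun _ _ => abs_nonneg _)
    _ = ∏ i ∈ t, |b i| := mul_one _

/-- Powers of a small quantity: `0 ≤ σ ≤ κ e`, `e ≤ 1`, `κ ≥ 1`, `1 ≤ m ≤ ℓ` give `σ^m ≤ κ^ℓ e`.
[folklore] -/
theorem pow_le_pow_mul_of_le {σ κ e : ℝ} {m ℓ : ℕ} (hσ0 : 0 ≤ σ) (hσ : σ ≤ κ * e) (he0 : 0 ≤ e)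
    (he1 : e ≤ 1) (hκ : 1 ≤ κ) (hm : 1 ≤ m) (hmℓ : m ≤ ℓ) : σ ^ m ≤ κ ^ ℓ * e := by
  obtain ⟨m', rfl⟩ : ∃ m', m = m' + 1 := ⟨m - 1, by omega⟩
  have hσκ : σ ≤ κ := hσ.trans (by nlinarith)
  have hκ0 : 0 ≤ κ := by linarith
  calc σ ^ (m' + 1) = σ ^ m' * σ := pow_succ σ m'
    _ ≤ κ ^ m' * (κ * e) :=
        mul_le_mul (pow_le_pow_left₀ hσ0 hσκ m') hσ (by positivity) (pow_nonneg hκ0 _)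
    _ = κ ^ (m' + 1) * e := by ring
    _ ≤ κ ^ ℓ * e := mul_le_mul_of_nonneg_right (pow_le_pow_right₀ hκ hmℓ) he0

end TaoTeravainen

open TaoTeravainen

/-- **Proposition 6.3 at `k = 0` from Lemma 6.1.**
[cite: TaoTeravainen2021, proof of Proposition 6.3 (case k = 0), Lemma 6.1, (2.12)] -/
theorem TaoTeravainen2021_prop63_k0_of_lemma61 (h61 : TaoTeravainen2021_lemma61) :
    TaoTeravainen2021_prop63_k0 := by
  classical
  intro H hH hH1 ψ hψ
  set ℓ : ℕ := #H with hℓdef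
  have hℓ1 : 1 ≤ ℓ := card_pos.mpr hH
  have hℓ1' : (1 : ℝ) ≤ ℓ := by exact_mod_cast hℓ1
  have hℓ0 : (0 : ℝ) < ℓ := by linarith
  obtain ⟨ε₁, hε₁, h61'⟩ := h61 ℓ hℓ1 ψ hψ
  refine ⟨min ε₁ 1, lt_min hε₁ one_pos, fun ε₀ hε₀ hε₀1 => ?_⟩
  have hε₀ε₁ : ε₀ ≤ ε₁ := hε₀1.trans (min_le_left _ _)
  have hε₀1' : ε₀ ≤ 1 := hε₀1.trans (min_le_right _ _)
  obtain ⟨C, K, η₁, hmain⟩ := h61' ε₀ hε₀ hε₀ε₁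
  obtain ⟨c, hc⟩ := exists_log_le_log_conductor_add
  -- constants
  set C₁ : ℝ := max C 1 with hC₁
  have hC₁1 : 1 ≤ C₁ := le_max_right _ _
  set κ : ℝ := max (K 1) 1 with hκdef
  have hκ1 : 1 ≤ κ := le_max_right _ _
  set hmax : ℕ := H.max' hH with hhmax
  have hhmax1 : 1 ≤ hmax := (hH1 _ (H.min'_mem hH)).trans (H.min'_le_max' hH)
  set Lmin : ℝ := |c| + 2 * Real.log ((hmax : ℝ) + 1) + 2 with hLmin
  refine ⟨(2 : ℝ) ^ ℓ * C₁ ^ ℓ * κ ^ ℓ * ((hmax : ℝ) ^ (ℓ * ℓ) + 1) * (80 * ℓ / ε₀),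
    max η₁ (max 10 (Real.exp Lmin)), ?_⟩
  intro q _ χ η hS hη x hlo hhi
  /- thresholds and sizes -/
  have hη₁ : η₁ ≤ η := (le_max_left _ _).trans hη
  have hη0 : 0 < η := by linarith [hS.ten_le]
  set L : ℝ := Real.log η with hLdef
  have hL1 : 1 ≤ L := by
    rw [hLdef, ← Real.log_exp 1]
    refine Real.log_le_log (Real.exp_pos 1) (le_trans ?_ hS.ten_le)
    have := Real.exp_one_lt_d9; linarith
  have hL0 : 0 < L := by linarith
  have hLmin_le : Lmin ≤ L := by
    rw [hLdef, ← Real.log_exp Lmin]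
    exact Real.log_le_log (Real.exp_pos _) ((le_max_right _ _).trans ((le_max_right _ _).trans hη))
  have hq1 : (1 : ℝ) ≤ q := by exact_mod_cast NeZero.one_le
  have hq1' : (1 : ℝ) < q := by exact_mod_cast (lt_of_lt_of_le (by norm_num) hS.three_le : 1 < q)
  have hq0 : (0 : ℝ) < q := by linarith
  have hxlo1 : (1 : ℝ) < (q : ℝ) ^ ((1 : ℝ) / 2 + ε₀) := Real.one_lt_rpow hq1' (by linarith)
  have hx1 : (1 : ℝ) < x := hxlo1.trans_le hlo
  have hx1' : (1 : ℝ) ≤ x := hx1.le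
  have hx0 : (0 : ℝ) < x := by linarith
  have hxℕ : 0 < x := by exact_mod_cast hx0
  have hlogx0 : 0 < Real.log x := Real.log_pos hx1
  -- `x ≥ h_max` (Siegel: `log x ≥ (log η - c)/2`)
  have hhmax_x : hmax ≤ x := by
    have h1 : Real.log ((q : ℝ) ^ ((1 : ℝ) / 2 + ε₀)) ≤ Real.log x := Real.log_le_log (by positivity) hlo
    rw [Real.log_rpow hq0] at h1
    have h2 := hc q χ η hS
    have hlogq0 : 0 ≤ Real.log q := Real.log_nonneg hq1
    have h3 : Real.log ((hmax : ℝ) + 1) ≤ Real.log x := by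
      have habs : c ≤ |c| := le_abs_self c
      have hε₀q : 0 ≤ ε₀ * Real.log q := mul_nonneg hε₀.le hlogq0
      linarith
    have h4 : (hmax : ℝ) + 1 ≤ x := (Real.log_le_log_iff (by positivity) hx0).mp h3
    exact_mod_cast (show (hmax : ℝ) ≤ x by linarith)
  /- the scales -/
  set t : ℝ := L ^ ((1 : ℝ) / 5) with ht
  have ht1 : 1 ≤ t := Real.one_le_rpow hL1 (by norm_num)
  have ht0 : 0 < t := by linarith
  have hsqt : Real.sqrt t = L ^ ((1 : ℝ) / 10) := by
    rw [Real.sqrt_eq_rpow, ht, ← Real.rpow_mul hL0.le]; norm_num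
  have hsqt0 : 0 < Real.sqrt t := Real.sqrt_pos.mpr ht0
  have hsqt_t : Real.sqrt t ≤ t := by
    have htt : t ≤ t ^ 2 := by
      calc t = t * 1 := (mul_one t).symm
        _ ≤ t * t := mul_le_mul_of_nonneg_left ht1 ht0.le
        _ = t ^ 2 := (sq t).symm
    calc Real.sqrt t ≤ Real.sqrt (t ^ 2) := Real.sqrt_le_sqrt htt
      _ = t := Real.sqrt_sq ht0.le
  set R : ℝ := scaleR η x with hRdef
  set D : ℝ := scaleD ℓ ε₀ x with hDdef
  have hRx : R = (x : ℝ) ^ (1 / t) := rfl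
  have hDx : D = (x : ℝ) ^ (ε₀ / (10 * ℓ)) := rfl
  have hexp0 : 0 < ε₀ / (10 * ℓ) := by positivity
  have hD1 : 1 < D := by rw [hDx]; exact Real.one_lt_rpow hx1 hexp0
  have hD0 : 0 < D := by linarith
  set N : ℕ := ⌊D⌋₊ with hNdef
  have hN1 : 1 ≤ N := Nat.le_floor (by simpa using hD1.le)
  have hND : (N : ℝ) ≤ D := Nat.floor_le hD0.le
  have hN1' : (1 : ℝ) ≤ N := by exact_mod_cast hN1
  have hNℓ : (N : ℝ) ^ ℓ ≤ x := by
    have h1 : D ^ ℓ = (x : ℝ) ^ (ε₀ / 10) := by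
      rw [← Real.rpow_natCast, hDx, ← Real.rpow_mul hx0.le]
      congr 1
      field_simp
    calc (N : ℝ) ^ ℓ ≤ D ^ ℓ := pow_le_pow_left₀ (Nat.cast_nonneg _) hND ℓ
      _ = (x : ℝ) ^ (ε₀ / 10) := h1
      _ ≤ (x : ℝ) ^ (1 : ℝ) := Real.rpow_le_rpow_of_exponent_le hx1' (by linarith)
      _ = x := Real.rpow_one _
  -- `e = exp(-⅛ log D / log R) = exp(-ε₀ t/(80ℓ))`, and `e ≤ (80ℓ/ε₀)/√t`
  set e : ℝ := Real.exp (-(1 / 8) * (Real.log D / Real.log R)) with hedef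
  have he0 : 0 ≤ e := (Real.exp_pos _).le
  have hratio : Real.log D / Real.log R = ε₀ * t / (10 * ℓ) := by
    rw [hDx, hRx, Real.log_rpow hx0, Real.log_rpow hx0]
    field_simp
  have he1 : e ≤ 1 := by
    rw [hedef, hratio]
    exact Real.exp_le_one_iff.mpr (by
      have : 0 ≤ ε₀ * t / (10 * ℓ) := by positivity
      linarith)
  have he_le : e ≤ 80 * ℓ / ε₀ / Real.sqrt t := by
    have hu : 0 < ε₀ * t / (80 * ℓ) := by positivity
    have h1 : e = Real.exp (-(ε₀ * t / (80 * ℓ))) := by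
      rw [hedef, hratio]; congr 1; ring
    have h2 : Real.exp (-(ε₀ * t / (80 * ℓ))) ≤ 1 / (ε₀ * t / (80 * ℓ)) := by
      rw [Real.exp_neg, inv_eq_one_div]
      exact one_div_le_one_div_of_le hu (by linarith [Real.add_one_le_exp (ε₀ * t / (80 * ℓ))])
    calc e ≤ 1 / (ε₀ * t / (80 * ℓ)) := h1 ▸ h2
      _ = 80 * ℓ / ε₀ / t := by field_simp
      _ ≤ 80 * ℓ / ε₀ / Real.sqrt t := div_le_div_of_nonneg_left (by positivity) hsqt0 hsqt_t
  /- Lemma 6.1 -/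
  obtain ⟨α, hα0, h64, h66⟩ := hmain q χ η hS hη₁ x hlo hhi
  -- `σ₁ = ∑ α(d)/d ≤ κ e`, `σ₀ = ∑ α(d) ≤ N κ e`
  set σ₁ : ℝ := ∑ d ∈ Icc 1 N, α d / d with hσ₁
  set σ₀ : ℝ := ∑ d ∈ Icc 1 N, α d with hσ₀
  have hσ₁0 : 0 ≤ σ₁ := sum_nonneg fun d _ => div_nonneg (hα0 d) (Nat.cast_nonneg _)
  have hσ₀0 : 0 ≤ σ₀ := sum_nonneg fun d _ => hα0 d
  have hσ₁le : σ₁ ≤ κ * e := by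
    have h1 := h66 1 le_rfl
    calc σ₁ ≤ ∑ d ∈ Icc 1 N, (#d.divisors : ℝ) ^ (1 : ℝ) * α d / d := by
          refine sum_le_sum fun d hd => ?_
          rw [mem_Icc] at hd
          rw [Real.rpow_one]
          have hτ : (1 : ℝ) ≤ #d.divisors := by
            exact_mod_cast Finset.card_pos.mpr ⟨1, Nat.one_mem_divisors.mpr (by omega)⟩
          have hd0 : (0 : ℝ) < d := by exact_mod_cast hd.1
          rw [div_le_div_iff_of_pos_right hd0]
          exact le_mul_of_one_le_left (hα0 d) hτ
      _ ≤ K 1 * e := h1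
      _ ≤ κ * e := mul_le_mul_of_nonneg_right (le_max_left _ _) he0
  have hσ₀le : σ₀ ≤ (N * κ) * e := by
    calc σ₀ ≤ ∑ d ∈ Icc 1 N, (N : ℝ) * (α d / d) := by
          refine sum_le_sum fun d hd => ?_
          rw [mem_Icc] at hd
          have hd0 : (0 : ℝ) < d := by exact_mod_cast hd.1
          have hdN : (d : ℝ) ≤ N := by exact_mod_cast hd.2
          rw [mul_div_assoc', le_div_iff₀ hd0, mul_comm]
          exact mul_le_mul_of_nonneg_right hdN (hα0 d)
      _ = N * σ₁ := by rw [hσ₁, mul_sum]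
      _ ≤ N * (κ * e) := mul_le_mul_of_nonneg_left hσ₁le (Nat.cast_nonneg _)
      _ = (N * κ) * e := by ring
  /- per `n`: expand the product over subsets -/
  set Hn : ℕ → ℝ := fun m => ∑ d ∈ (Icc 1 N).filter (· ∣ m), α d with hHn
  have hHn0 : ∀ m, 0 ≤ Hn m := fun m => sum_nonneg fun d _ => hα0 d
  set P' := H.powerset.erase ∅ with hP'
  have hP'card : (#P' : ℝ) ≤ (2 : ℝ) ^ ℓ := by
    have : #P' ≤ 2 ^ ℓ := (card_erase_le).trans (by rw [card_powerset])
    exact_mod_cast this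
  have hpoint : ∀ n ∈ Icc 1 x,
      |∏ a ∈ H, liouvilleSiegel χ R (n + a) - ∏ a ∈ H, liouvilleSiegelSharp χ ψ R D (n + a)| ≤
        ∑ t ∈ P', C₁ ^ ℓ * ∏ a ∈ t, Hn (n + a) := by
    intro n hn
    rw [mem_Icc] at hn
    set b : ℕ → ℝ := fun a => liouvilleSiegelSharp χ ψ R D (n + a) - liouvilleSiegel χ R (n + a)
      with hb
    have hrw : ∏ a ∈ H, liouvilleSiegelSharp χ ψ R D (n + a) =
        ∏ a ∈ H, (liouvilleSiegel χ R (n + a) + b a) :=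
      prod_congr rfl fun a _ => by simp [hb]
    rw [hrw]
    refine (abs_prod_sub_prod_add_le H _ b fun a _ => abs_liouvilleSiegel_le_one χ R _).trans ?_
    refine sum_le_sum fun t ht => ?_
    have htH : t ⊆ H := mem_powerset.mp (mem_of_mem_erase ht)
    have htℓ : #t ≤ ℓ := card_le_card htH
    -- each `|b(n+a)| ≤ C₁ H(n+a)`
    have hba : ∀ a ∈ t, |b a| ≤ C₁ * Hn (n + a) := by
      intro a ha
      have haH := htH ha
      have ha1 := hH1 a haH
      have hax : a ≤ x := (H.le_max' a haH).trans hhmax_x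
      have hnx : (n : ℝ) ≤ x := by exact_mod_cast hn.2
      have hax' : (a : ℝ) ≤ x := by exact_mod_cast hax
      have h := h64 (n + a) (by omega) (by push_cast; linarith)
      rw [hb]
      dsimp only
      rw [abs_sub_comm]
      exact h.trans (mul_le_mul_of_nonneg_right (le_max_left _ _) (hHn0 _))
    calc ∏ a ∈ t, |b a| ≤ ∏ a ∈ t, C₁ * Hn (n + a) :=
          prod_le_prod (fun _ _ => abs_nonneg _) hba
      _ = C₁ ^ #t * ∏ a ∈ t, Hn (n + a) := by rw [prod_mul_distrib, prod_const]
      _ ≤ C₁ ^ ℓ * ∏ a ∈ t, Hn (n + a) :=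
          mul_le_mul_of_nonneg_right (pow_le_pow_right₀ hC₁1 htℓ) (prod_nonneg fun _ _ => hHn0 _)
  /- sum over `n` and over the subsets -/
  have hsum : ∑ n ∈ Icc 1 x,
      |∏ a ∈ H, liouvilleSiegel χ R (n + a) - ∏ a ∈ H, liouvilleSiegelSharp χ ψ R D (n + a)| ≤
        (2 : ℝ) ^ ℓ * C₁ ^ ℓ * κ ^ ℓ * ((hmax : ℝ) ^ (ℓ * ℓ) + 1) * e * x := by
    have hsubset : ∀ t ∈ P', ∑ n ∈ Icc 1 x, ∏ a ∈ t, Hn (n + a) ≤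
        x * κ ^ ℓ * ((hmax : ℝ) ^ (ℓ * ℓ) + 1) * e := by
      intro t ht
      have htH : t ⊆ H := mem_powerset.mp (mem_of_mem_erase ht)
      have htℓ : #t ≤ ℓ := card_le_card htH
      have htne : t.Nonempty := nonempty_iff_ne_empty.mpr (ne_of_mem_erase ht)
      have ht1 : 1 ≤ #t := card_pos.mpr htne
      have hmaj := sum_prod_majorant_le t hhmax1 (fun a ha => H.le_max' a (htH ha)) hα0 N x
      have h1 : σ₁ ^ #t ≤ κ ^ ℓ * e := pow_le_pow_mul_of_le hσ₁0 hσ₁le he0 he1 hκ1 ht1 htℓ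
      have hNκ : 1 ≤ (N : ℝ) * κ := one_le_mul_of_one_le_of_one_le hN1' hκ1
      have h2 : σ₀ ^ #t ≤ ((N : ℝ) * κ) ^ ℓ * e := pow_le_pow_mul_of_le hσ₀0 hσ₀le he0 he1 hNκ ht1 htℓ
      have h3 : ((N : ℝ) * κ) ^ ℓ * e ≤ x * κ ^ ℓ * e := by
        rw [mul_pow]
        exact mul_le_mul_of_nonneg_right (mul_le_mul_of_nonneg_right hNℓ (by positivity)) he0
      have hh1 : (1 : ℝ) ≤ hmax := by exact_mod_cast hhmax1
      have h4 : (hmax : ℝ) ^ (#t * #t) ≤ (hmax : ℝ) ^ (ℓ * ℓ) :=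
        pow_le_pow_right₀ hh1 (Nat.mul_le_mul htℓ htℓ)
      calc ∑ n ∈ Icc 1 x, ∏ a ∈ t, Hn (n + a)
          ≤ (x : ℝ) * (hmax : ℝ) ^ (#t * #t) * σ₁ ^ #t + σ₀ ^ #t := hmaj
        _ ≤ (x : ℝ) * (hmax : ℝ) ^ (ℓ * ℓ) * (κ ^ ℓ * e) + x * κ ^ ℓ * e := by
            refine add_le_add (mul_le_mul (mul_le_mul_of_nonneg_left h4 (Nat.cast_nonneg _)) h1
              (pow_nonneg hσ₁0 _) (by positivity)) (h2.trans h3)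
        _ = x * κ ^ ℓ * ((hmax : ℝ) ^ (ℓ * ℓ) + 1) * e := by ring
    calc ∑ n ∈ Icc 1 x,
          |∏ a ∈ H, liouvilleSiegel χ R (n + a) - ∏ a ∈ H, liouvilleSiegelSharp χ ψ R D (n + a)|
        ≤ ∑ n ∈ Icc 1 x, ∑ t ∈ P', C₁ ^ ℓ * ∏ a ∈ t, Hn (n + a) := sum_le_sum hpoint
      _ = ∑ t ∈ P', C₁ ^ ℓ * ∑ n ∈ Icc 1 x, ∏ a ∈ t, Hn (n + a) := by
          rw [sum_comm]; simp_rw [mul_sum]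
      _ ≤ ∑ _t ∈ P', C₁ ^ ℓ * (x * κ ^ ℓ * ((hmax : ℝ) ^ (ℓ * ℓ) + 1) * e) :=
          sum_le_sum fun t ht => mul_le_mul_of_nonneg_left (hsubset t ht) (by positivity)
      _ = #P' * (C₁ ^ ℓ * (x * κ ^ ℓ * ((hmax : ℝ) ^ (ℓ * ℓ) + 1) * e)) := by
          rw [sum_const, nsmul_eq_mul]
      _ ≤ (2 : ℝ) ^ ℓ * (C₁ ^ ℓ * (x * κ ^ ℓ * ((hmax : ℝ) ^ (ℓ * ℓ) + 1) * e)) :=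
          mul_le_mul_of_nonneg_right hP'card (by positivity)
      _ = (2 : ℝ) ^ ℓ * C₁ ^ ℓ * κ ^ ℓ * ((hmax : ℝ) ^ (ℓ * ℓ) + 1) * e * x := by ring
  /- conclusion -/
  have hL10 : 0 < Real.log η ^ ((1 : ℝ) / 10) := Real.rpow_pos_of_pos hL0 _
  simp only [tupleAverage]
  rw [← sub_div, ← sum_sub_distrib, abs_div, abs_of_pos hx0, div_le_iff₀ hx0]
  refine (abs_sum_le_sum_abs _ _).trans (hsum.trans ?_)
  have hBig : 0 ≤ (2 : ℝ) ^ ℓ * C₁ ^ ℓ * κ ^ ℓ * ((hmax : ℝ) ^ (ℓ * ℓ) + 1) := by positivity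
  calc (2 : ℝ) ^ ℓ * C₁ ^ ℓ * κ ^ ℓ * ((hmax : ℝ) ^ (ℓ * ℓ) + 1) * e * x
      ≤ (2 : ℝ) ^ ℓ * C₁ ^ ℓ * κ ^ ℓ * ((hmax : ℝ) ^ (ℓ * ℓ) + 1) * (80 * ℓ / ε₀ / Real.sqrt t) * x :=
        mul_le_mul_of_nonneg_right (mul_le_mul_of_nonneg_left he_le hBig) hx0.le
    _ = (2 : ℝ) ^ ℓ * C₁ ^ ℓ * κ ^ ℓ * ((hmax : ℝ) ^ (ℓ * ℓ) + 1) * (80 * ℓ / ε₀) /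
          L ^ ((1 : ℝ) / 10) * x := by
        rw [hsqt]; ring

end Literature.Barriers.Parity
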